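import Literature.AnabelianGeometry.EtaleTheta.FrobenioidThetaBiKummer
import Literature.AnabelianGeometry.EtaleTheta.FrobenioidCyclotomicRigidity

/-!
# [EtTh] §5: glue for Prop. 5.5 (uniqueness) and Prop. 5.2 (iii) ⇒ Prop. 4.3 (iii) — proofs (pp. 324–331 / PDF pp. 98–105)

Mochizuki, *The étale theta function and its Frobenioid-theoretic manifestations*, Publ. RIMS **45**
(2009) [cite: MochizukiEtTh2009, Prop 5.5 p.101 (PRIMS p.327)].  Layer L2 of the abc-iut cell, seat
abc-iut-L2-t11 (wave-2 unit W2-L2-07, light discharge of §5).  PROOF-ONLY companion (no new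
definitions) of abc-iut-L2-t4's `FrobenioidCyclotomicRigidity.lean` (Prop. 5.5:
`FrobenioidCyclotomicRigidity.CyclotomicRigidity`, `IsKummerDetermined`, `IsFunctorialLinear`,
`LinearlyReachableFromBN`, `rigidityFamily_unique_of`) and `FrobenioidThetaBiKummer.lean` (Prop. 5.2
(iii): `FrobenioidThetaBiKummer.ThetaPairKummerClass`; Prop. 4.3 (iii) instance
`BiKummerDifferenceMem`).  (Lemma 5.9 (v), which needs `FrobenioidMonoThetaEnv.lean`, is reduced by the
same glue in `Discharge/Sec5BiThetaIso.lean`, `cycRigidityCoincide_of`.)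

What is PROVED here, each MODULO hypotheses stated inline (no new named `Prop`s):
* `rigidityFamily_eq_on_BN_of_isKummerDetermined` — two rigidity families that are both "determined
  by the second Kummer class of Proposition 5.2, (iii)" on `B_N` (p.101 (PRIMS p.327)) AGREE on `B_N`,
  provided the part of `H_{B_N}` lying over `(l·Δ_Θ)_{B_N}` maps ONTO `(l·Δ_Θ)_{B_N} ⊗ ℤ/Nℤ` (the
  coverage hypothesis `hcov`; in print: `Π^tp_Ÿ̲ ↠ l·Δ_Θ ⊗ ℤ/Nℤ`, since `Δ_Θ` is a quotient of
  `Π^tp_Ÿ`, §1 p.12 (PRIMS p.238));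
* `cyclotomicRigidity_unique_of`, `cyclotomicRigidity_of` — the UNIQUENESS half of Prop. 5.5
  ("independent of the choice …", proof p.102 (PRIMS p.328)) from abc-iut-L2-t4's transport step
  `LinearlyReachableFromBN` + coverage, and Prop. 5.5 itself modulo its existence half;
* `biKummerDifferenceMem_of_thetaPairKummerClass` — Prop. 5.2 (iii) (cocycle form) implies the
  Prop. 4.3 (iii) instance "the difference `s^⊔-gp_N · (s^⊓-gp_N)⁻¹` is `μ_N(B_N)`-valued" (using
  the normality of `μ_N(B_N)`, abc-iut-L2-t4's `muTorsion_normal`);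
* `pow_N_eq_one_of_mem_muTorsion_image` — the elementary half of the kernel clause of Lemma 5.8's
  "`(K^×)^{1/N}/μ_N(B_N) ⥲ K^×`" (abc-iut-L2-t4's `KxRootNModCyclotome`): images of `μ_N(B_N)` in
  `O^×(B_N^birat)` are killed by `N`.
NOT proved (reported on STATUS as needing geometric input): the EXISTENCE half of Prop. 5.5 ("it
follows from the detailed description of the 'étale theta class' in Proposition 1.3 that the resulting
Kummer class … determines an isomorphism", p.101–102), Prop. 5.2 (i)(ii), Prop. 5.3 (i)–(vi).
HONEST FRAMING: [EtTh] is refereed; nothing of it is asserted unconditionally; typed ≠ proved;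
discharged-modulo ≠ unconditional; no side is taken on any disputed claim downstream.
-/

namespace Literature.AnabelianGeometry.EtaleTheta

open CategoryTheory
open FrobenioidCyclotomicRigidity

universe w v v' u u'

namespace ThetaFrobenioid

section Rigidity

variable {C : Type u} [Category.{v} C] {D : Type u'} [Category.{v'} D]
  (𝔉 : ThetaFrobenioid.{w} C D)

/-- **Prop. 5.5, "determines an isomorphism" is single-valued on `B_N`**: two candidate rigidity
families that are both Kummer-determined on `B_N` (abc-iut-L2-t4's `IsKummerDetermined`: on the part of
`H_{B_N}` over `(l·Δ_Θ)_{B_N}` they are read off from `h ↦ s^⊓-gp_N(h) · s^⊔-gp_N(h)⁻¹`) agree on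
`B_N`, provided that part of `H_{B_N}` maps ONTO `(l·Δ_Θ)_{B_N} ⊗ ℤ/Nℤ` (`hcov`; in print `Δ_Θ` is a
quotient of `Π^tp_Ÿ`, §1 p.12 (PRIMS p.238)).  [cite: MochizukiEtTh2009, Prop 5.5 p.101 (PRIMS p.327)] -/
theorem rigidityFamily_eq_on_BN_of_isKummerDetermined (P : ThetaSubquotientProj 𝔉)
    (hB : 𝔉.IsThetaSaturated 𝔉.BN)
    (hcov : ∀ x : 𝔉.lDeltaModN 𝔉.BN, ∃ (h : 𝔉.HB)
      (hh : (h : Aut (𝔉.base.obj 𝔉.BN)) ∈ P.pre (𝔉.base.obj 𝔉.BN)),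
      (QuotientGroup.mk (P.proj _ ⟨h, hh⟩) : 𝔉.lDeltaModN 𝔉.BN) = x)
    {ρ ρ' : RigidityFamily 𝔉} (hρ : IsKummerDetermined 𝔉 P ρ hB)
    (hρ' : IsKummerDetermined 𝔉 P ρ' hB) : ρ 𝔉.BN hB = ρ' 𝔉.BN hB := by
  apply MulEquiv.ext
  intro x
  obtain ⟨h, hh, rfl⟩ := hcov x
  apply Subtype.ext
  rw [hρ h hh, hρ' h hh]

/-- **Prop. 5.5, uniqueness half DISCHARGED MODULO** abc-iut-L2-t4's transport step
`LinearlyReachableFromBN` (proof p.102 (PRIMS p.328): every theta-saturated `S` receives a linear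
morphism from `B_N` inducing isomorphisms on `(l·Δ_Θ) ⊗ ℤ/Nℤ` and `μ_N`) and the coverage hypothesis:
"this isomorphism is … independent of the choice of `S''`, `S'''`, and the linear morphisms … precisely
because of the original 'functoriality'".  Combines `rigidityFamily_eq_on_BN_of_isKummerDetermined`
with abc-iut-L2-t4's `rigidityFamily_unique_of`.  [cite: MochizukiEtTh2009, Prop 5.5 p.101 (PRIMS p.327)] -/
theorem cyclotomicRigidity_unique_of (P : ThetaSubquotientProj 𝔉) (hB : 𝔉.IsThetaSaturated 𝔉.BN)
    (hreach : LinearlyReachableFromBN 𝔉)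
    (hcov : ∀ x : 𝔉.lDeltaModN 𝔉.BN, ∃ (h : 𝔉.HB)
      (hh : (h : Aut (𝔉.base.obj 𝔉.BN)) ∈ P.pre (𝔉.base.obj 𝔉.BN)),
      (QuotientGroup.mk (P.proj _ ⟨h, hh⟩) : 𝔉.lDeltaModN 𝔉.BN) = x)
    (ρ ρ' : RigidityFamily 𝔉) (hK : IsKummerDetermined 𝔉 P ρ hB) (hF : IsFunctorialLinear 𝔉 ρ)
    (hK' : IsKummerDetermined 𝔉 P ρ' hB) (hF' : IsFunctorialLinear 𝔉 ρ') : ρ = ρ' :=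
  rigidityFamily_unique_of 𝔉 hreach hB hF hF'
    (𝔉.rigidityFamily_eq_on_BN_of_isKummerDetermined P hB hcov hK hK')

/-- **[EtTh] Proposition 5.5 (Frobenioid-theoretic Cyclotomic Rigidity) DISCHARGED MODULO its
existence half** (abc-iut-L2-t4's `CyclotomicRigidity` = existence ∧ uniqueness): given SOME rigidity
family that is Kummer-determined on `B_N` and functorial for linear morphisms (the existence half:
"it follows from the detailed description of the 'étale theta class' in Proposition 1.3 that the
resulting Kummer class … determines an isomorphism", proof pp.101–102 (PRIMS pp.327–328) — geometric
input, NOT proved here), the transport step and coverage, Prop. 5.5 holds.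
[cite: MochizukiEtTh2009, Prop 5.5 p.101 (PRIMS p.327)] -/
theorem cyclotomicRigidity_of (P : ThetaSubquotientProj 𝔉) (hB : 𝔉.IsThetaSaturated 𝔉.BN)
    (hreach : LinearlyReachableFromBN 𝔉)
    (hcov : ∀ x : 𝔉.lDeltaModN 𝔉.BN, ∃ (h : 𝔉.HB)
      (hh : (h : Aut (𝔉.base.obj 𝔉.BN)) ∈ P.pre (𝔉.base.obj 𝔉.BN)),
      (QuotientGroup.mk (P.proj _ ⟨h, hh⟩) : 𝔉.lDeltaModN 𝔉.BN) = x)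
    (hex : ∃ ρ : RigidityFamily 𝔉, IsKummerDetermined 𝔉 P ρ hB ∧ IsFunctorialLinear 𝔉 ρ) :
    CyclotomicRigidity 𝔉 P hB :=
  ⟨hex, 𝔉.cyclotomicRigidity_unique_of P hB hreach hcov⟩

/-! ### Prop. 5.2 (iii) ⇒ the Prop. 4.3 (iii) instance; the kernel clause of Lemma 5.8 -/

/-- **Prop. 5.2 (iii) (cocycle form) ⇒ the bi-Kummer difference `s^⊓-gp_N · (s^⊔-gp_N)⁻¹` (equivalently
its inverse) is `μ_N(B_N)`-valued** (the Prop. 4.3 (iii) instance abc-iut-L2-t4 takes as the named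
hypothesis `BiKummerDifferenceMem`): if the difference cocycle equals a `μ_N(B_N)`-coboundary times `ν ∘ η`
(their `ThetaPairKummerClass η ν`, print's orientation since v3), it lies in `μ_N(B_N)` — using that
`μ_N(B_N)` is normal in `Aut_C(B_N)` (abc-iut-L2-t4's `muTorsion_normal`, from their PROVED
`O^×(B_N) = Ker`) and closed under inverses.  [cite: MochizukiEtTh2009, Prop 5.2 (iii) p.98 (PRIMS p.324)] -/
theorem biKummerDifferenceMem_of_thetaPairKummerClass
    (η : 𝔉.HB → 𝔉.lDeltaModN 𝔉.BN) (ν : 𝔉.lDeltaModN 𝔉.BN ≃* 𝔉.muTorsion 𝔉.BN 𝔉.N)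
    (h : FrobenioidThetaBiKummer.ThetaPairKummerClass 𝔉 η ν) : 𝔉.BiKummerDifferenceMem := by
  obtain ⟨u, hu, hall⟩ := h
  rw [ThetaFrobenioid.biKummerDifferenceMem_iff]
  intro h'
  have hmem : (𝔉.sgpCap (h' : Aut (𝔉.base.obj 𝔉.BN)) * u *
        (𝔉.sgpCap (h' : Aut (𝔉.base.obj 𝔉.BN)))⁻¹ * u⁻¹) * (ν (η h') : Aut 𝔉.BN) ∈
      𝔉.muTorsion 𝔉.BN 𝔉.N :=
    (𝔉.muTorsion 𝔉.BN 𝔉.N).mul_mem ((𝔉.muTorsion 𝔉.BN 𝔉.N).mul_mem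
      ((𝔉.muTorsion_normal 𝔉.BN 𝔉.N).conj_mem u hu _) ((𝔉.muTorsion 𝔉.BN 𝔉.N).inv_mem hu))
      (ν (η h')).2
  exact hall h' ▸ hmem

/-- **Lemma 5.8, kernel clause — elementary half**: an element of `O^×(B_N^birat)` coming from
`μ_N(B_N) ⊆ O^×(B_N) ↪ O^×(B_N^birat)` is killed by `N` (one inclusion of "`(K^×)^{1/N}/μ_N(B_N) ⥲ K^×`",
abc-iut-L2-t4's `KxRootNModCyclotome`, second conjunct, `←`).  The converse (every `N`-torsion element of
`(K^×)^{1/N}` comes from `μ_N(B_N)`) is Kummer theory of `K` and is NOT proved here.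
[cite: MochizukiEtTh2009, Lem 5.8 p.105 (PRIMS p.331)] -/
theorem pow_N_eq_one_of_mem_muTorsion_image {f : 𝔉.biratUnits 𝔉.BN}
    (hf : f ∈ ((𝔉.unitsToBirat 𝔉.BN).comp
      (Subgroup.inclusion (𝔉.muTorsion_le_units 𝔉.BN 𝔉.N))).range) :
    f ^ (𝔉.N : ℕ) = 1 := by
  obtain ⟨u, rfl⟩ := hf
  have hu : u ^ (𝔉.N : ℕ) = 1 := Subtype.ext (by simpa using u.2.2)
  rw [← map_pow, hu, map_one]

end Rigidity


end ThetaFrobenioid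

end Literature.AnabelianGeometry.EtaleTheta
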